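import Mathlib
import HarnessLib

/-!
# Stub T3 of line `blowdown-kills-pitch` of crux `SymmetricLiouville`: the slab kernel bound

Crux stmt-NavierStokesRegularity-4053, route `SymmetryModuliCount`.

Pure measure theory. In the symmetry-free Oseen bootstrap the sources near the sheet through the
observation point `x ≠ 0` are integrated FIRST over the plane orthogonal to `x̂ = x/‖x‖`: with
`y₁ = ⟪y, x⟫/‖x‖` and `y' ⊥ x̂` the remaining coordinates, `‖x − y‖² = (‖x‖ − y₁)² + ‖y'‖²`, and
for `c > 0`

  `∫_{ℝ²} (c + ‖y'‖²)^{-2} dy' ≤ (∫_ℝ dt/(c + t²))² = π²/c`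

(pointwise `(c + p² + q²)² ≥ (c + p²)(c + q²)`, then Tonelli and `∫_ℝ dt/(c + t²) = π/√c`).
Since the weight `F` depends on `y₁` only, Tonelli in adapted orthonormal coordinates
(`OrthonormalBasis.measurePreserving_repr`, `MeasurableEquiv.piFinSuccAbove`) gives

  `∫_{|y₁| ≤ a} (σ + ‖x − y‖²)^{-2} F(y₁) dy ≤ π² ∫_{−a}^{a} (σ + (‖x‖ − r)²)^{-1} F(r) dr`,

i.e. the statement `stub_slabKernelBound` with `A = π²` (the sharp constant is `π`).
-/

noncomputable section

-- `Summit.NavierStokesRegularity.NavierStokesRegularity.…` is the registry's summit/problem path.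
set_option linter.dupNamespace false

open Set Function MeasureTheory Module
open scoped ENNReal

/-- Local notation for physical space `ℝ³` (the spelling of the registered stub signature). -/
local notation "E3" => EuclideanSpace ℝ (Fin 3)

namespace Summit.NavierStokesRegularity.NavierStokesRegularity.Theorems.SymmetryModuliCountSymmetricLiouville

/-- The elementary inequality `((c + p² + q²)⁻¹)² ≤ (c + p²)⁻¹ (c + q²)⁻¹` for `c > 0`
(expand `(c + p² + q²)² − (c + p²)(c + q²) = c(p² + q²) + p⁴ + p²q² + q⁴ ≥ 0`). -/
theorem inv_add_sq_add_sq_sq_le {c : ℝ} (hc : 0 < c) (p q : ℝ) :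
    (c + p ^ 2 + q ^ 2)⁻¹ ^ 2 ≤ (c + p ^ 2)⁻¹ * (c + q ^ 2)⁻¹ := by
  have hp : 0 < c + p ^ 2 := by positivity
  have hq : 0 < c + q ^ 2 := by positivity
  rw [← mul_inv, inv_pow]
  apply inv_anti₀ (mul_pos hp hq)
  nlinarith [sq_nonneg p, sq_nonneg q, mul_nonneg (sq_nonneg p) (sq_nonneg q),
    mul_nonneg hc.le (sq_nonneg p), mul_nonneg hc.le (sq_nonneg q)]

/-- `∫_ℝ dt/(c + t²) = π/√c` for `c > 0`, as a lower Lebesgue integral (substitute `t = √c u`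
in Mathlib's `∫ du/(1 + u²) = π`). -/
theorem lintegral_inv_const_add_sq {c : ℝ} (hc : 0 < c) :
    ∫⁻ t : ℝ, ENNReal.ofReal ((c + t ^ 2)⁻¹) = ENNReal.ofReal (Real.pi / Real.sqrt c) := by
  have hsc : 0 < Real.sqrt c := Real.sqrt_pos.2 hc
  have hcc : Real.sqrt c * Real.sqrt c = c := Real.mul_self_sqrt hc.le
  set κ : ℝ := (Real.sqrt c)⁻¹ with hκ
  have hκ0 : κ ≠ 0 := (inv_pos.2 hsc).ne'
  have hH : Measurable fun u : ℝ => ENNReal.ofReal (c⁻¹ * (1 + u ^ 2)⁻¹) :=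
    ENNReal.measurable_ofReal.comp (by fun_prop)
  have hpt : ∀ t : ℝ, (c + t ^ 2)⁻¹ = c⁻¹ * (1 + (κ * t) ^ 2)⁻¹ := by
    intro t
    rw [← mul_inv, hκ, mul_pow, inv_pow, Real.sq_sqrt hc.le]
    congr 1
    field_simp
  have h1 : ∫⁻ u : ℝ, ENNReal.ofReal ((1 + u ^ 2)⁻¹) = ENNReal.ofReal Real.pi := by
    rw [← ofReal_integral_eq_lintegral_ofReal integrable_inv_one_add_sq
      (ae_of_all _ fun x => by positivity), integral_univ_inv_one_add_sq]
  calc ∫⁻ t : ℝ, ENNReal.ofReal ((c + t ^ 2)⁻¹)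
      = ∫⁻ t : ℝ, ENNReal.ofReal (c⁻¹ * (1 + (κ * t) ^ 2)⁻¹) := by simp_rw [hpt]
    _ = ∫⁻ u, ENNReal.ofReal (c⁻¹ * (1 + u ^ 2)⁻¹) ∂(Measure.map (fun t => κ * t) volume) :=
        (lintegral_map hH (measurable_const_mul κ)).symm
    _ = ENNReal.ofReal |κ⁻¹| * ∫⁻ u, ENNReal.ofReal (c⁻¹ * (1 + u ^ 2)⁻¹) := by
        rw [Real.map_volume_mul_left hκ0, lintegral_smul_measure, smul_eq_mul]
    _ = ENNReal.ofReal |κ⁻¹| * (ENNReal.ofReal c⁻¹ * ENNReal.ofReal Real.pi) := by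
        congr 1
        rw [← h1, ← lintegral_const_mul' _ _ ENNReal.ofReal_ne_top]
        refine lintegral_congr fun u => ?_
        rw [ENNReal.ofReal_mul (inv_nonneg.2 hc.le)]
    _ = ENNReal.ofReal (Real.pi / Real.sqrt c) := by
        rw [← ENNReal.ofReal_mul (inv_nonneg.2 hc.le), ← ENNReal.ofReal_mul (abs_nonneg _),
          hκ, inv_inv, abs_of_pos hsc]
        congr 1
        have hinv : c⁻¹ = (Real.sqrt c)⁻¹ * (Real.sqrt c)⁻¹ := by rw [← mul_inv, hcc]
        rw [hinv, ← mul_assoc, ← mul_assoc, mul_inv_cancel₀ hsc.ne', one_mul, div_eq_inv_mul]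

/-- Tonelli for a product of two one-variable factors on `Fin 2 → ℝ`:
`∫ g(z₀) g(z₁) dz = (∫ g)²` (`MeasurableEquiv.finTwoArrow`, `lintegral_prod_mul`). -/
theorem lintegral_fin_two_mul_eq {g : ℝ → ℝ≥0∞} (hg : Measurable g) :
    ∫⁻ z : Fin 2 → ℝ, g (z 0) * g (z 1) = (∫⁻ t, g t) * ∫⁻ t, g t := by
  have hm : Measurable fun q : ℝ × ℝ => g q.1 * g q.2 :=
    (hg.comp measurable_fst).mul (hg.comp measurable_snd)
  have h := (volume_preserving_finTwoArrow ℝ).lintegral_comp hm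
  have h' : ∀ z : Fin 2 → ℝ, MeasurableEquiv.finTwoArrow z = (z 0, z 1) := fun z => rfl
  simp only [h'] at h
  rw [h, Measure.volume_eq_prod, lintegral_prod_mul hg.aemeasurable hg.aemeasurable]

/-- **The planar kernel bound**: for `c > 0`,
`∫_{ℝ²} dz / (c + z₀² + z₁²)² ≤ π²/c` (product bound and `∫ dt/(c + t²) = π/√c` twice). -/
theorem lintegral_inv_sq_plane_le {c : ℝ} (hc : 0 < c) :
    ∫⁻ z : Fin 2 → ℝ, ENNReal.ofReal ((c + z 0 ^ 2 + z 1 ^ 2)⁻¹ ^ 2) ≤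
      ENNReal.ofReal (Real.pi ^ 2) * ENNReal.ofReal c⁻¹ := by
  have hg : Measurable fun t : ℝ => ENNReal.ofReal ((c + t ^ 2)⁻¹) :=
    ENNReal.measurable_ofReal.comp (by fun_prop)
  have hcc : Real.sqrt c * Real.sqrt c = c := Real.mul_self_sqrt hc.le
  calc ∫⁻ z : Fin 2 → ℝ, ENNReal.ofReal ((c + z 0 ^ 2 + z 1 ^ 2)⁻¹ ^ 2)
      ≤ ∫⁻ z : Fin 2 → ℝ,
          ENNReal.ofReal ((c + z 0 ^ 2)⁻¹) * ENNReal.ofReal ((c + z 1 ^ 2)⁻¹) := by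
        refine lintegral_mono fun z => ?_
        rw [← ENNReal.ofReal_mul (inv_nonneg.2 (by positivity))]
        exact ENNReal.ofReal_le_ofReal (inv_add_sq_add_sq_sq_le hc _ _)
    _ = ENNReal.ofReal (Real.pi / Real.sqrt c) * ENNReal.ofReal (Real.pi / Real.sqrt c) := by
        rw [lintegral_fin_two_mul_eq hg, lintegral_inv_const_add_sq hc]
    _ = ENNReal.ofReal (Real.pi ^ 2) * ENNReal.ofReal c⁻¹ := by
        rw [← ENNReal.ofReal_mul (by positivity), ← ENNReal.ofReal_mul (by positivity)]
        congr 1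
        rw [div_mul_div_comm, hcc, sq, div_eq_mul_inv]

/-- **Stub T3 — the slab kernel bound** (`A = π²`). For `x ≠ 0`, `σ > 0`, `a ∈ ℝ` and a
measurable weight `F ≥ 0` of the coordinate `y₁ = ⟪y, x⟫/‖x‖` only,
`∫_{|y₁| ≤ a} (σ + ‖x − y‖²)^{-2} F(y₁) dy ≤ π² ∫_{[−a, a]} (σ + (‖x‖ − r)²)^{-1} F(r) dr`:
adapted orthonormal coordinates with `b 0 = x/‖x‖` (volume preserving), Tonelli, and the planar
bound `lintegral_inv_sq_plane_le` on each slice `y₁ = r`, where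
`‖x − y‖² = (‖x‖ − r)² + ‖y'‖²`. -/
theorem stub_slabKernelBound :
    ∃ A : ℝ, 0 < A ∧ ∀ x : E3, x ≠ 0 → ∀ σ : ℝ, 0 < σ → ∀ (a : ℝ) (F : ℝ → ℝ≥0∞), Measurable F →
      ∫⁻ y in {y : E3 | |inner ℝ y x| ≤ a * ‖x‖},
          ENNReal.ofReal ((σ + ‖x - y‖ ^ 2)⁻¹ ^ 2) * F (inner ℝ y x / ‖x‖) ≤
        ENNReal.ofReal A * ∫⁻ r in Set.Icc (-a) a, ENNReal.ofReal ((σ + (‖x‖ - r) ^ 2)⁻¹) * F r := by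
  refine ⟨Real.pi ^ 2, by positivity, fun x hx σ hσ a F hF => ?_⟩
  set R : ℝ := ‖x‖ with hR
  have hR0 : 0 < R := norm_pos_iff.2 hx
  -- an orthonormal basis whose first vector is `x/‖x‖`
  obtain ⟨b, hb0⟩ : ∃ b : OrthonormalBasis (Fin 3) ℝ E3, b 0 = R⁻¹ • x := by
    have he1 : ‖R⁻¹ • x‖ = 1 := by
      rw [norm_smul, norm_inv, Real.norm_eq_abs, abs_of_pos hR0, inv_mul_cancel₀ hR0.ne']
    have hv : Orthonormal ℝ (({0} : Set (Fin 3)).restrict fun _ : Fin 3 => R⁻¹ • x) :=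
      ⟨fun _ => he1, fun i j hij => absurd (Subsingleton.elim i j) hij⟩
    obtain ⟨b, hb⟩ := Orthonormal.exists_orthonormalBasis_extension_of_card_eq
      (𝕜 := ℝ) (E := E3) (by simp) hv
    exact ⟨b, hb 0 rfl⟩
  have hxb : x = R • b 0 := by rw [hb0, smul_smul, mul_inv_cancel₀ hR0.ne', one_smul]
  -- the coordinates of `x` and `y` in the basis `b`
  have hinner : ∀ y : E3, inner ℝ y x = R * b.repr y 0 := fun y => by
    rw [b.repr_apply_apply, hb0, real_inner_smul_left, real_inner_comm x y, ← mul_assoc,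
      mul_inv_cancel₀ hR0.ne', one_mul]
  have hx' : b.repr x = R • EuclideanSpace.single (0 : Fin 3) (1 : ℝ) := by
    conv_lhs => rw [hxb]
    rw [map_smul, b.repr_self]
  have hnorm : ∀ y : E3,
      ‖x - y‖ ^ 2 = (R - b.repr y 0) ^ 2 + b.repr y 1 ^ 2 + b.repr y 2 ^ 2 := fun y => by
    rw [← b.repr.norm_map (x - y), map_sub, EuclideanSpace.real_norm_sq_eq, Fin.sum_univ_three,
      hx']
    simp
  -- the one-variable data
  set c : ℝ → ℝ := fun s => σ + (R - s) ^ 2 with hc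
  have hc0 : ∀ s, 0 < c s := fun s => by positivity
  set G : ℝ → ℝ≥0∞ := (Icc (-a) a).indicator F with hG
  have hGm : Measurable G := hF.indicator measurableSet_Icc
  set Ψ : ℝ × (Fin 2 → ℝ) → ℝ≥0∞ :=
    fun p => G p.1 * ENNReal.ofReal ((c p.1 + p.2 0 ^ 2 + p.2 1 ^ 2)⁻¹ ^ 2) with hΨ
  have hΨm : Measurable Ψ :=
    (hGm.comp measurable_fst).mul (ENNReal.measurable_ofReal.comp (by fun_prop))
  set sp := MeasurableEquiv.piFinSuccAbove (fun _ : Fin 3 => ℝ) 0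
  have hspm : MeasurePreserving sp volume volume := volume_preserving_piFinSuccAbove _ 0
  have hφ : MeasurePreserving (fun y : E3 => WithLp.ofLp (b.repr y)) volume volume :=
    (PiLp.volume_preserving_ofLp (Fin 3)).comp b.measurePreserving_repr
  -- the slab
  set S : Set E3 := {y : E3 | |inner ℝ y x| ≤ a * ‖x‖}
  have hSm : MeasurableSet S :=
    measurableSet_le ((continuous_id.inner continuous_const).measurable.abs) measurable_const
  -- pointwise comparison of the integrand with `Ψ` in the adapted coordinates
  have hpt : ∀ y : E3,
      S.indicator (fun y => ENNReal.ofReal ((σ + ‖x - y‖ ^ 2)⁻¹ ^ 2) *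
        F (inner ℝ y x / ‖x‖)) y ≤ Ψ (sp (WithLp.ofLp (b.repr y))) := by
    intro y
    by_cases hy : y ∈ S
    · have h1 : (sp (WithLp.ofLp (b.repr y))).1 = b.repr y 0 := rfl
      have h20 : (sp (WithLp.ofLp (b.repr y))).2 0 = b.repr y 1 := rfl
      have h21 : (sp (WithLp.ofLp (b.repr y))).2 1 = b.repr y 2 := rfl
      have hs : inner ℝ y x / ‖x‖ = b.repr y 0 := by
        rw [hinner, ← hR, mul_div_cancel_left₀ _ hR0.ne']
      have hxy : σ + ‖x - y‖ ^ 2 = c (b.repr y 0) + b.repr y 1 ^ 2 + b.repr y 2 ^ 2 := by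
        rw [hnorm y]
        simp only [hc]
        ring
      have hmem : b.repr y 0 ∈ Icc (-a) a := by
        have h : |inner ℝ y x| ≤ a * ‖x‖ := hy
        rw [hinner, ← hR, abs_mul, abs_of_pos hR0, mul_comm] at h
        exact abs_le.1 (le_of_mul_le_mul_right h hR0)
      rw [indicator_of_mem hy, hΨ]
      simp only [h1, h20, h21]
      rw [hs, hG, indicator_of_mem hmem, hxy, mul_comm]
    · rw [indicator_of_notMem hy]
      exact zero_le
  -- the slices `y₁ = s`
  have hslice : ∀ s : ℝ, ∫⁻ z : Fin 2 → ℝ, Ψ (s, z) ≤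
      ENNReal.ofReal (Real.pi ^ 2) *
        (Icc (-a) a).indicator (fun r => ENNReal.ofReal (c r)⁻¹ * F r) s := by
    intro s
    have hz : Measurable fun z : Fin 2 → ℝ =>
        ENNReal.ofReal ((c s + z 0 ^ 2 + z 1 ^ 2)⁻¹ ^ 2) :=
      ENNReal.measurable_ofReal.comp (by fun_prop)
    calc ∫⁻ z : Fin 2 → ℝ, Ψ (s, z)
        = G s * ∫⁻ z : Fin 2 → ℝ, ENNReal.ofReal ((c s + z 0 ^ 2 + z 1 ^ 2)⁻¹ ^ 2) := by
          rw [← lintegral_const_mul _ hz]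
      _ ≤ G s * (ENNReal.ofReal (Real.pi ^ 2) * ENNReal.ofReal (c s)⁻¹) := by
          gcongr
          exact lintegral_inv_sq_plane_le (hc0 s)
      _ = ENNReal.ofReal (Real.pi ^ 2) *
            (Icc (-a) a).indicator (fun r => ENNReal.ofReal (c r)⁻¹ * F r) s := by
          by_cases hs : s ∈ Icc (-a) a
          · simp only [hG, indicator_of_mem hs]
            ring
          · rw [hG, indicator_of_notMem hs, indicator_of_notMem hs, zero_mul, mul_zero]
  -- assembling
  calc ∫⁻ y in S, ENNReal.ofReal ((σ + ‖x - y‖ ^ 2)⁻¹ ^ 2) * F (inner ℝ y x / ‖x‖)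
      = ∫⁻ y, S.indicator (fun y => ENNReal.ofReal ((σ + ‖x - y‖ ^ 2)⁻¹ ^ 2) *
          F (inner ℝ y x / ‖x‖)) y := (lintegral_indicator hSm _).symm
    _ ≤ ∫⁻ y, Ψ (sp (WithLp.ofLp (b.repr y))) := lintegral_mono hpt
    _ = ∫⁻ w, Ψ (sp w) := hφ.lintegral_comp (hΨm.comp sp.measurable)
    _ = ∫⁻ p, Ψ p := hspm.lintegral_comp hΨm
    _ = ∫⁻ s, ∫⁻ z, Ψ (s, z) := by
        rw [Measure.volume_eq_prod]
        exact lintegral_prod _ hΨm.aemeasurable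
    _ ≤ ∫⁻ s, ENNReal.ofReal (Real.pi ^ 2) *
          (Icc (-a) a).indicator (fun r => ENNReal.ofReal (c r)⁻¹ * F r) s :=
        lintegral_mono hslice
    _ = ENNReal.ofReal (Real.pi ^ 2) *
          ∫⁻ r in Icc (-a) a, ENNReal.ofReal ((σ + (‖x‖ - r) ^ 2)⁻¹) * F r := by
        rw [lintegral_const_mul' _ _ ENNReal.ofReal_ne_top, lintegral_indicator measurableSet_Icc]

end Summit.NavierStokesRegularity.NavierStokesRegularity.Theorems.SymmetryModuliCountSymmetricLiouville
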